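import Summits.KontsevichZagierPeriods.KontsevichZagierPeriods.Theses.SymplecticScissors
import Summits.KontsevichZagierPeriods.KontsevichZagierPeriods.Theses.DimensionBudget
import Summits.KontsevichZagierPeriods.KontsevichZagierPeriods.Theorems.LiftingCriteriaCubeNashNormalFormDimLeOne
import Summits.KontsevichZagierPeriods.KontsevichZagierPeriods.Theorems.SymplecticScissorsCubeNashNormalFormChartCompiler
import Summits.KontsevichZagierPeriods.KontsevichZagierPeriods.Theorems.SymplecticScissorsCubeNashNormalFormCubeMonomializationOne
import Summits.KontsevichZagierPeriods.KontsevichZagierPeriods.Theorems.SymplecticScissorsCubeNashNormalFormAbhyankarJung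
import Summits.KontsevichZagierPeriods.KontsevichZagierPeriods.Theorems.SymplecticScissorsCubeNashNormalFormToricPrincipalization
import Summits.KontsevichZagierPeriods.KontsevichZagierPeriods.Theorems.SymplecticScissorsCubeNashNormalFormRootDifferenceDivisor
import Summits.KontsevichZagierPeriods.KontsevichZagierPeriods.Theorems.SymplecticScissorsCubeNashNormalFormJungPrepare
import Mathlib.RingTheory.Polynomial.Resultant.Basic
import Mathlib.Analysis.Analytic.Basic

/-!
# Crux `CubeNashNormalForm` (stmt-KontsevichZagierPeriods-3574) — line `Sketch`
# (card `jung-descent-abhyankar-toric`): JUNG'S INDUCTION, NOT HIRONAKA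

Skeleton of the line lead (prover-line-stmt-KontsevichZagierPeriods-3574-0), rebuilt from the card
`Cruxes/CubeNashNormalForm/Ideas/jung-descent-abhyankar-toric.md` (the ideator's `Sketch.lean` is
evidence-only and not mounted here). It concludes the crux BY NAME — all three route decls
`LiftingCriteria.CubeNashNormalForm` (home), `SymplecticScissors.CubeNashNormalForm`,
`DimensionBudget.CubeNashNormalForm` (byte-identical bodies) — from seven registered stubs through the
LANDED reduction `LiftingCriteria.CubeNashNormalFormDimLeOne.cubeNashNormalForm_of_boundedCubeResolution_three`
(dimensions `≤ 2` are in the tree; what remains is: every bounded integrand-`1` solid of dimension `≥ 3`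
is, modulo `KZ.relations`, in the span of TAME cube classes).

## Vocabulary (spelled out verbatim inside every stub; no defs, no notation)

* closed / open unit cube of `ℝᵈ`: `Set.pi Set.univ (fun _ => Set.Icc 0 1)` / `(… Set.Ioo 0 1)`.
* CHART FORMAT for `Φ : ℝᵈ → ℝᵈ`: analytic AT every point of the closed cube, `ℚ`-semialgebraic on the
  OPEN cube, injective on the open cube, `det DΦ ≠ 0` on the open cube. (Nothing is asked of `Φ` off the
  cube beyond analyticity at the closed cube; the compiler stub derives the Jacobian integrand
  `g = ±det DΦ`, analytic near the closed cube and semialgebraic on it, and closes cubes through the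
  landed fold `CubeNashNormalFormTame.of_mem_of_isTameCube`.)
* CUBE-MONOMIAL near the closed cube: `F = (∏ xᵢ^{aᵢ} (1 - xᵢ)^{bᵢ}) · e` on an open `U ⊇` closed cube
  with `e` analytic and nowhere zero on `U`.
* `E(d)` (cube-monomialization = the card's `CubeMonomialization d`): every bounded `ℚ`-semialgebraic
  `B ⊆ ℝᵈ` is, off a null set, the disjoint union of finitely many open-cube images of FORMAT charts
  along each of which every member of a prescribed finite family of non-zero polynomials over `ℚ` is
  cube-monomial. With the EMPTY family, `E(m+3)` is verbatim a tame cell atlas of the solid.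
* `AJ(d)` (Abhyankar–Jung near the closed cube): a monic `T`-polynomial with coefficients analytic on
  `U ⊇` closed cube whose discriminant `Res(P, P')` is `(∏ xᵢ^{αᵢ}) ·` (analytic unit) splits, after the
  ramification `xᵢ = σᵢ^N`, into linear factors `T − ζ_l(σ)` with `ζ_l : ℝᵈ → ℂ` analytic near the
  closed cube. [Abhyankar 1955; Jung 1908; Kiyek–Vicente 2004 Cor. V.3.3; Parusiński–Rond 2012]
* `TORIC(n)`: for a finite set of exponents there are finitely many monomial charts `v ↦ (∏ⱼ vⱼ^{A i j})ᵢ`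
  (`A ∈ ℕ^{n×n}`, `det A ≠ 0` — simplicial, unimodularity is NOT needed for real-analytic charts) whose
  open-cube images are pairwise disjoint and exhaust the open cube up to a null set, and along each of
  which the pulled-back exponents `Aᵀa` of the given set are pairwise comparable (simplicial refinement
  of the fan cut out by the hyperplanes `⟨a − b, ·⟩ = 0`). [Fulton 1993 §2.6; Goward 2005]
* `DIV(d)` (divisors of a normal-crossing monomial): if `f·g = (∏ xᵢ^{aᵢ})·e` with `f, g, e : ℝᵈ → ℂ`
  analytic on `U ⊇` closed cube and `e ≠ 0`, then `f = (∏ xᵢ^{bᵢ})·u`, `u` analytic and nowhere zero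
  near the closed cube (Newton-polyhedron argument in `ℂ{x − p}` at each point `p`, glued along faces).
* `PREP(d)` (output of JungPrepare): as `E(d+1)` but with each `Qⱼ ∘ Φᵢ` only in BINOMIAL PRODUCT FORM:
  (cube-monomial · unit) · ∏ (M₁e₁ + M₂e₂)^{m} · ∏ ((M₃e₃ + M₄e₄)² + M₅e₅)^{m'} with cube-monomials `M`
  and POSITIVE analytic units `e` near the closed cube (real-root factors `(w_k − w_l) + w·gap`,
  conjugate-pair factors `(t − Re ρ)² + (Im ρ)²`; single terms are written `M(e/2) + M(e/2)`).

## Stubs (7) and composition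

* `stub_chartCompiler` (M) — FORMAT atlas of `K.domain` (integrand `1`) ⇒ `[K] ≡ c ∈ cubicalSpan`:
  one `KZ.changeOfVariablesRel` per chart, domain additivity over the disjoint a.e. cover, null sets
  are relations, open cube → closed cube across its null boundary, tame cube class.
* `stub_cubeMonomializationOne` (S–M) — `E(1)`: cut a bounded semialgebraic `B ⊆ ℝ` at the real roots,
  affine charts of the intervals; `Q(a + w(b − a)) = w^{m}(1 − w)^{m'} · unit`.
* `stub_jungPrepare` (XL) — `E(d) ∧ AJ(d) ∧ DIV(d) ⇒ PREP(d)` (`d ≥ 1`): CAD of `B` adapted to the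
  family; shear `t ↦ t + c·x` (`c ∈ ℚᵈ`) to make the product `R` monic in `t`; midpoint augmentation
  `R⁺ = rad Res_s(R(s), R(2t − s))` (real parts of complex roots become real roots, all wall differences
  divide `disc_t R⁺`); `E(d)` on each base cell for `{disc_t R⁺, lc's}`; dyadic localisation and
  ramification; `AJ(d)`; `DIV(d)` for root differences; slab charts `t = w_k(s) + w·(w_{k+1} − w_k)(s)`.
* `stub_jungFinish` (M–L) — `TORIC(d+1) ∧ PREP(d) ⇒ E(d+1)`: dyadic localisation of the `(d+1)`-cube
  (far-face factors become units), simplicial toric charts making all exponent pairs comparable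
  (`M₁u₁ + M₂u₂ = M_min · unit`, then `(…)² + M₅u₅` likewise), composition of FORMAT charts, null images.
* `stub_abhyankarJung` (XL, the lead's) — `AJ(d)` for all `d`.
* `stub_toricPrincipalization` (M–L) — `TORIC(n)` for all `n`.
* `stub_rootDifferenceDivisor` (M–L) — `DIV(d)` for all `d`.

STATUS 2026-08-17T14Z: stubs S1 (p143039), S2 (p143476), S3 (p163096: JungPrepare, global assembly of the
Literature chart package `JungPreparation.exists_chart_package`), S5 (p145564: Abhyankar–Jung PROVED, Literature
`Analysis/Complex/{PolynomialRootCover,AbhyankarJungAnalytic,AbhyankarJungReal}`), S6 (p144295), S7 (p143678)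
are LANDED and imported below; only `stub_jungFinish` remains `sorry`.

Composition (sorry-free below): `E(1)`; `E(d) ⇒ E(d+1)` (`d ≥ 1`) by JungPrepare + JungFinish; `E(m+3)`
with the empty family is an atlas; the compiler gives `c ∈ cubicalSpan`; the landed reduction gives the
crux. Disproof used: none exists for this crux (`ledger crux ls`: no Disproof.lean, 2026-08-17T04:30Z).
-/

noncomputable section

-- single-conjunct summit: Sub = Summit (CONVENTIONS §2)
set_option linter.dupNamespace false

open Set MeasureTheory
open Literature.ModelTheory.ExponentialFields (IsSemialgebraic)
open Literature.NumberTheory.Transcendental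
open Literature.NumberTheory.Transcendental.KZ

namespace Summit.KontsevichZagierPeriods.KontsevichZagierPeriods.Cruxes.CubeNashNormalForm.JungToric

/-! ## Stubs -/

/-- **Stub S1 `stub_chartCompiler` (the chart compiler; provable now, M).** A FORMAT atlas of the
domain of an integrand-`1` representation `K` (charts analytic at the closed cube, `ℚ`-semialgebraic,
injective and with non-vanishing Jacobian on the open cube; open-cube images inside `K.domain`,
pairwise disjoint, exhausting it up to a null set) puts `[K]`, modulo `KZ.relations`, in the span of
the tame cube classes: per chart one change-of-variables move `[(0,1)ⁿ, |det DΦᵢ|] − [Φᵢ '' (0,1)ⁿ, 1]`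
(`|det DΦᵢ| = ±det DΦᵢ` is analytic near the closed cube and `ℚ`-semialgebraic on it), domain
additivity over the disjoint cover and the null remainder, and `(0,1)ⁿ → [0,1]ⁿ` across the null
boundary. [Kontsevich–Zagier 2001, §1.2 rules (1), (2); Ayoub 2014, Rem. 12] -/
theorem stub_chartCompiler : ∀ (n : ℕ) (K : IntegralRep n), (∀ x ∈ K.domain, K.integrand x = 1) → ∀ (N : ℕ) (Φ : Fin N → (Fin n → ℝ) → (Fin n → ℝ)), (∀ i, (AnalyticOnNhd ℝ (Φ i) (Set.pi Set.univ (fun _ : Fin n => Set.Icc (0:ℝ) 1)) ∧ IsSemialgebraicMapOn ℚ (Set.pi Set.univ (fun _ : Fin n => Set.Ioo (0:ℝ) 1)) (Φ i) ∧ Set.InjOn (Φ i) (Set.pi Set.univ (fun _ : Fin n => Set.Ioo (0:ℝ) 1)) ∧ ∀ x ∈ Set.pi Set.univ (fun _ : Fin n => Set.Ioo (0:ℝ) 1), (fderiv ℝ (Φ i) x).det ≠ 0)) → (∀ i, Φ i '' Set.pi Set.univ (fun _ : Fin n => Set.Ioo (0:ℝ) 1) ⊆ K.domain) → Pairwise (fun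 i i' => Disjoint (Φ i '' Set.pi Set.univ (fun _ : Fin n => Set.Ioo (0:ℝ) 1)) (Φ i' '' Set.pi Set.univ (fun _ : Fin n => Set.Ioo (0:ℝ) 1))) → MeasureTheory.volume (K.domain \ ⋃ i, Φ i '' Set.pi Set.univ (fun _ : Fin n => Set.Ioo (0:ℝ) 1)) = 0 → ∃ c ∈ Summit.KontsevichZagierPeriods.FurushoPentagon.ReducedPeriodRing.cubicalSpan, of K - c ∈ relations :=
  Summit.KontsevichZagierPeriods.SymplecticScissors.CubeNashNormalFormChartCompiler.stub_chartCompiler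

/-- **Stub S2 `stub_cubeMonomializationOne` (`E(1)`; provable now, S–M).** A bounded
`ℚ`-semialgebraic `B ⊆ ℝ¹` is a finite union of points and open intervals with real-algebraic end
points; cutting moreover at the real roots of the `Qⱼ` and parametrising each interval affinely by the
open unit interval, `Qⱼ(a + w(b − a)) = w^{m}(1 − w)^{m'} ·` (a polynomial with no root on `[0,1]`).
[Bochnak–Coste–Roy 1998, §2.1] -/
theorem stub_cubeMonomializationOne : (∀ (B : Set (Fin 1 → ℝ)), IsSemialgebraic ℚ B → Bornology.IsBounded B → ∀ (k : ℕ) (Q : Fin k → MvPolynomial (Fin 1) ℚ), (∀ j, Q j ≠ 0) → ∃ (N : ℕ) (Φ : Fin N → (Fin 1 → ℝ) → (Fin 1 → ℝ)), (∀ i, (AnalyticOnNhd ℝ (Φ i) (Set.pi Set.univ (fun _ : Fin 1 => Set.Icc (0:ℝ) 1)) ∧ IsSemialgebraicMapOn ℚ (Set.pi Set.univ (fun _ : Fin 1 => Set.Ioo (0:ℝ) 1)) (Φ i) ∧ Set.InjOn (Φ i) (Set.pi Set.univ (fun _ : Fin 1 => Set.Ioo (0:ℝ) 1)) ∧ ∀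 x ∈ Set.pi Set.univ (fun _ : Fin 1 => Set.Ioo (0:ℝ) 1), (fderiv ℝ (Φ i) x).det ≠ 0)) ∧ (∀ i, Φ i '' Set.pi Set.univ (fun _ : Fin 1 => Set.Ioo (0:ℝ) 1) ⊆ B) ∧ Pairwise (fun i i' => Disjoint (Φ i '' Set.pi Set.univ (fun _ : Fin 1 => Set.Ioo (0:ℝ) 1)) (Φ i' '' Set.pi Set.univ (fun _ : Fin 1 => Set.Ioo (0:ℝ) 1))) ∧ MeasureTheory.volume (B \ ⋃ i, Φ i '' Set.pi Set.univ (fun _ : Fin 1 => Set.Ioo (0:ℝ) 1)) = 0 ∧ ∀ i j, (∃ U : Set (Fin 1 → ℝ), IsOpen U ∧ Set.pi Set.univ (fun _ : Fin 1 => Set.Icc (0:ℝ) 1) ⊆ U ∧ ∃ (a b : Fin 1 → ℕ) (e : (Fin 1 → ℝ) → ℝ), AnalyticOnNhd ℝ e U ∧ (∀ x ∈ U, e x ≠ 0) ∧ ∀ x ∈ U, (fun x => MvPolynomial.aeval (Φ i x) (Q j)) x = (∏ i, x i ^ a i * (1 - x i) ^ b i) * e x)) :=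
  Summit.KontsevichZagierPeriods.SymplecticScissors.CubeNashNormalFormCubeMonomializationOne.stub_cubeMonomializationOne

/-- **Stub S3 `stub_jungPrepare` (Jung's projection step, XL).** From cube-monomialization `E(d)` of
the base, Abhyankar–Jung `AJ(d)` and the divisor lemma `DIV(d)`: every bounded `ℚ`-semialgebraic
`B ⊆ ℝᵈ⁺¹` is a.e. the disjoint union of open-cube images of FORMAT slab charts
`(s, w) ↦ (φ(s), w_k(s) + w·(w_{k+1} − w_k)(s))` along which every `Qⱼ` is in binomial product form
`PREP(d)`. Steps: cylindrical decomposition adapted to `B` and the `Qⱼ`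
(`exists_isCylindricalDecomposition_forall_sign_eq`), merge bands across non-root sections; `ℚ`-shear
`t ↦ t + c·x` making `R = rad ∏ Qⱼ` monic in `t`; midpoint augmentation
`R⁺ = rad Res_s(R(x,s), R(x,2t−s))`; `E(d)` on each bounded base cell for `disc_t R⁺` and the leading
coefficients; dyadic localisation `xᵢ = yᵢ/2`, `1 − yᵢ/2` and `AJ(d)`; real walls = real-valued roots of
`R⁺` (ordered, analytic near the closed cube); `DIV(d)`: wall differences and squared imaginary parts
are cube-monomial · unit; factor `Qⱼ(φ(s), w_k + w·gap) = c_j(φ(s)) ∏ (t − ρ)`.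
[Jung 1908; Kollár 2007, §2.3; Kiyek–Vicente 2004, Rem. V.4.4; Basu–Pollack–Roy 2006, Thm. 5.6] -/
theorem stub_jungPrepare : ∀ d : ℕ, 1 ≤ d → (∀ (B : Set (Fin d → ℝ)), IsSemialgebraic ℚ B → Bornology.IsBounded B → ∀ (k : ℕ) (Q : Fin k → MvPolynomial (Fin d) ℚ), (∀ j, Q j ≠ 0) → ∃ (N : ℕ) (Φ : Fin N → (Fin d → ℝ) → (Fin d → ℝ)), (∀ i, (AnalyticOnNhd ℝ (Φ i) (Set.pi Set.univ (fun _ : Fin d => Set.Icc (0:ℝ) 1)) ∧ IsSemialgebraicMapOn ℚ (Set.pi Set.univ (fun _ : Fin d => Set.Ioo (0:ℝ) 1)) (Φ i) ∧ Set.InjOn (Φ i) (Set.pi Set.univ (fun _ : Fin d => Set.Ioo (0:ℝ) 1)) ∧ ∀ x ∈ Set.pi Set.univ (fun _ : Fin d => Set.Ioo (0:ℝ) 1), (fderiv ℝ (Φ i) x).det ≠ 0)) ∧ (∀ i, Φ i '' Set.pi Set.univ (fun _ : Fin d => Set.Ioo (0:ℝ) 1) ⊆ B) ∧ Pairwise (fun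 i i' => Disjoint (Φ i '' Set.pi Set.univ (fun _ : Fin d => Set.Ioo (0:ℝ) 1)) (Φ i' '' Set.pi Set.univ (fun _ : Fin d => Set.Ioo (0:ℝ) 1))) ∧ MeasureTheory.volume (B \ ⋃ i, Φ i '' Set.pi Set.univ (fun _ : Fin d => Set.Ioo (0:ℝ) 1)) = 0 ∧ ∀ i j, (∃ U : Set (Fin d → ℝ), IsOpen U ∧ Set.pi Set.univ (fun _ : Fin d => Set.Icc (0:ℝ) 1) ⊆ U ∧ ∃ (a b : Fin d → ℕ) (e : (Fin d → ℝ) → ℝ), AnalyticOnNhd ℝ e U ∧ (∀ x ∈ U, e x ≠ 0) ∧ ∀ x ∈ U, (fun x => MvPolynomial.aeval (Φ i x) (Q j)) x = (∏ i, x i ^ a i * (1 - x i) ^ b i) * e x)) → (∀ (n : ℕ) (U : Set (Fin d → ℝ)), IsOpen U → Set.pi Set.univ (fun _ : Fin d => Set.Icc (0:ℝ) 1) ⊆ U → ∀ (a : Fin n → (Fin d → ℝ) → ℝ) (α : Fin d → ℕ) (e : (Fin d → ℝ) → ℝ), (∀ k, AnalyticOnNhd ℝ (a k) U) → AnalyticOnNhd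 ℝ e U → (∀ x ∈ U, e x ≠ 0) → (∀ x ∈ U, Polynomial.resultant (Polynomial.X ^ n + ∑ k : Fin n, Polynomial.C (a k (x)) * Polynomial.X ^ (k : ℕ)) (Polynomial.derivative (Polynomial.X ^ n + ∑ k : Fin n, Polynomial.C (a k (x)) * Polynomial.X ^ (k : ℕ))) = (∏ i, x i ^ α i) * e x) → ∃ N : ℕ, 0 < N ∧ ∃ V : Set (Fin d → ℝ), IsOpen V ∧ Set.pi Set.univ (fun _ : Fin d => Set.Icc (0:ℝ) 1) ⊆ V ∧ (∀ σ ∈ V, (fun i => σ i ^ N) ∈ U) ∧ ∃ ζ : Fin n → (Fin d → ℝ) → ℂ, (∀ l, AnalyticOnNhd ℝ (ζ l) V) ∧ ∀ σ ∈ V, ((Polynomial.X ^ n + ∑ k : Fin n, Polynomial.C (a k (fun i => σ i ^ N)) * Polynomial.X ^ (k : ℕ))).map (algebraMap ℝ ℂ) = ∏ l, (Polynomial.X - Polynomial.C (ζ l σ))) → (∀ (U : Set (Fin d → ℝ)), IsOpen U → Set.pi Set.univ (fun _ : Fin d => Set.Icc (0:ℝ) 1) ⊆ U → ∀ (f g e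 : (Fin d → ℝ) → ℂ) (a : Fin d → ℕ), AnalyticOnNhd ℝ f U → AnalyticOnNhd ℝ g U → AnalyticOnNhd ℝ e U → (∀ x ∈ U, e x ≠ 0) → (∀ x ∈ U, f x * g x = (∏ i, ((x i : ℝ) : ℂ) ^ a i) * e x) → ∃ (b : Fin d → ℕ) (V : Set (Fin d → ℝ)) (u : (Fin d → ℝ) → ℂ), IsOpen V ∧ Set.pi Set.univ (fun _ : Fin d => Set.Icc (0:ℝ) 1) ⊆ V ∧ V ⊆ U ∧ AnalyticOnNhd ℝ u V ∧ (∀ x ∈ V, u x ≠ 0) ∧ (∀ i, b i ≤ a i) ∧ ∀ x ∈ V, f x = (∏ i, ((x i : ℝ) : ℂ) ^ b i) * u x) → (∀ (B : Set (Fin (d + 1) → ℝ)), IsSemialgebraic ℚ B → Bornology.IsBounded B → ∀ (k : ℕ) (Q : Fin k → MvPolynomial (Fin (d + 1)) ℚ), (∀ j, Q j ≠ 0) → ∃ (N : ℕ) (Φ : Fin N → (Fin (d + 1) → ℝ) → (Fin (d + 1) → ℝ)), (∀ i, (AnalyticOnNhd ℝ (Φ i) (Set.pi Set.univ (fun _ :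 Fin (d + 1) => Set.Icc (0:ℝ) 1)) ∧ IsSemialgebraicMapOn ℚ (Set.pi Set.univ (fun _ : Fin (d + 1) => Set.Ioo (0:ℝ) 1)) (Φ i) ∧ Set.InjOn (Φ i) (Set.pi Set.univ (fun _ : Fin (d + 1) => Set.Ioo (0:ℝ) 1)) ∧ ∀ x ∈ Set.pi Set.univ (fun _ : Fin (d + 1) => Set.Ioo (0:ℝ) 1), (fderiv ℝ (Φ i) x).det ≠ 0)) ∧ (∀ i, Φ i '' Set.pi Set.univ (fun _ : Fin (d + 1) => Set.Ioo (0:ℝ) 1) ⊆ B) ∧ Pairwise (fun i i' => Disjoint (Φ i '' Set.pi Set.univ (fun _ : Fin (d + 1) => Set.Ioo (0:ℝ) 1)) (Φ i' '' Set.pi Set.univ (fun _ : Fin (d + 1) => Set.Ioo (0:ℝ) 1))) ∧ MeasureTheory.volume (B \ ⋃ i, Φ i '' Set.pi Set.univ (fun _ : Fin (d + 1) => Set.Ioo (0:ℝ) 1)) = 0 ∧ ∀ i j, (∃ U : Set (Fin (d + 1) → ℝ), IsOpen U ∧ Set.pi Set.univ (fun _ : Fin (d + 1) => Set.Icc (0:ℝ)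 1) ⊆ U ∧ ∃ (a₀ b₀ : Fin (d + 1) → ℕ) (e₀ : (Fin (d + 1) → ℝ) → ℝ) (L₁ L₂ : ℕ) (m₁ : Fin L₁ → ℕ) (a₁ b₁ a₂ b₂ : Fin L₁ → Fin (d + 1) → ℕ) (e₁ e₂ : Fin L₁ → (Fin (d + 1) → ℝ) → ℝ) (m₂ : Fin L₂ → ℕ) (a₃ b₃ a₄ b₄ a₅ b₅ : Fin L₂ → Fin (d + 1) → ℕ) (e₃ e₄ e₅ : Fin L₂ → (Fin (d + 1) → ℝ) → ℝ), AnalyticOnNhd ℝ e₀ U ∧ (∀ x ∈ U, e₀ x ≠ 0) ∧ (∀ l, AnalyticOnNhd ℝ (e₁ l) U ∧ AnalyticOnNhd ℝ (e₂ l) U ∧ ∀ x ∈ U, 0 < e₁ l x ∧ 0 < e₂ l x) ∧ (∀ l, AnalyticOnNhd ℝ (e₃ l) U ∧ AnalyticOnNhd ℝ (e₄ l) U ∧ AnalyticOnNhd ℝ (e₅ l) U ∧ ∀ x ∈ U, 0 < e₃ l x ∧ 0 < e₄ l x ∧ 0 < e₅ l x) ∧ ∀ x ∈ U, (fun x =>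 MvPolynomial.aeval (Φ i x) (Q j)) x = (∏ i, x i ^ a₀ i * (1 - x i) ^ b₀ i) * e₀ x * (∏ l, ((∏ i, x i ^ a₁ l i * (1 - x i) ^ b₁ l i) * e₁ l x + (∏ i, x i ^ a₂ l i * (1 - x i) ^ b₂ l i) * e₂ l x) ^ m₁ l) * ∏ l, (((∏ i, x i ^ a₃ l i * (1 - x i) ^ b₃ l i) * e₃ l x + (∏ i, x i ^ a₄ l i * (1 - x i) ^ b₄ l i) * e₄ l x) ^ 2 + (∏ i, x i ^ a₅ l i * (1 - x i) ^ b₅ l i) * e₅ l x) ^ m₂ l)) :=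
  Summit.KontsevichZagierPeriods.SymplecticScissors.CubeNashNormalFormJungPrepare.stub_jungPrepare

/-- **Stub S4 `stub_jungFinish` (toric repair of the corner binomials, M–L).** From `TORIC(d+1)` and
the prepared slab atlas `PREP(d)`: `E(d+1)`. Dyadic localisation of the `(d+1)`-cube into `2ᵈ⁺¹`
half-cubes rescaled to the unit cube (so every cube-monomial becomes a pure monomial times a positive
unit), then the simplicial monomial charts of `TORIC(d+1)` for the finite set of all exponents occurring
(and their doubles): on each chart `M₁u₁ + M₂u₂ = M · (unit > 0)` and `(M u)² + M₅u₅ = M' · (unit > 0)`;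
compositions of FORMAT charts are FORMAT charts (chain rule, `ℚ`-semialgebraic composition), images stay
disjoint, and analytic images of null sets are null. [Fulton 1993, §2.6; Kontsevich–Zagier 2001, §1.2] -/
theorem stub_jungFinish : ∀ d : ℕ, (∀ (S : Finset (Fin (d + 1) → ℕ)), ∃ (M : ℕ) (A : Fin M → Matrix (Fin (d + 1)) (Fin (d + 1)) ℕ), (∀ c, ((A c).map (fun t : ℕ => (t : ℝ))).det ≠ 0) ∧ Pairwise (fun c c' => Disjoint ((fun v : Fin (d + 1) → ℝ => fun i => ∏ j, v j ^ A c i j) '' Set.pi Set.univ (fun _ : Fin (d + 1) => Set.Ioo (0:ℝ) 1)) ((fun v : Fin (d + 1) → ℝ => fun i => ∏ j, v j ^ A c' i j) '' Set.pi Set.univ (fun _ : Fin (d + 1) => Set.Ioo (0:ℝ) 1))) ∧ MeasureTheory.volume (Set.pi Set.univ (fun _ : Fin (d + 1) => Set.Ioo (0:ℝ) 1) \ ⋃ c, (fun v : Fin (d + 1) → ℝ => fun i => ∏ j, v j ^ A c i j) '' Set.pi Set.univ (fun _ : Fin (d + 1) => Set.Ioo (0:ℝ) 1)) = 0 ∧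 ∀ c, ∀ a ∈ S, ∀ b ∈ S, (∀ j, ∑ i, A c i j * a i ≤ ∑ i, A c i j * b i) ∨ (∀ j, ∑ i, A c i j * b i ≤ ∑ i, A c i j * a i)) → (∀ (B : Set (Fin (d + 1) → ℝ)), IsSemialgebraic ℚ B → Bornology.IsBounded B → ∀ (k : ℕ) (Q : Fin k → MvPolynomial (Fin (d + 1)) ℚ), (∀ j, Q j ≠ 0) → ∃ (N : ℕ) (Φ : Fin N → (Fin (d + 1) → ℝ) → (Fin (d + 1) → ℝ)), (∀ i, (AnalyticOnNhd ℝ (Φ i) (Set.pi Set.univ (fun _ : Fin (d + 1) => Set.Icc (0:ℝ) 1)) ∧ IsSemialgebraicMapOn ℚ (Set.pi Set.univ (fun _ : Fin (d + 1) => Set.Ioo (0:ℝ) 1)) (Φ i) ∧ Set.InjOn (Φ i) (Set.pi Set.univ (fun _ : Fin (d + 1) => Set.Ioo (0:ℝ) 1)) ∧ ∀ x ∈ Set.pi Set.univ (fun _ : Fin (d + 1) => Set.Ioo (0:ℝ) 1), (fderiv ℝ (Φ i) x).det ≠ 0)) ∧ (∀ i, Φ i '' Set.pi Set.univ (fun _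 : Fin (d + 1) => Set.Ioo (0:ℝ) 1) ⊆ B) ∧ Pairwise (fun i i' => Disjoint (Φ i '' Set.pi Set.univ (fun _ : Fin (d + 1) => Set.Ioo (0:ℝ) 1)) (Φ i' '' Set.pi Set.univ (fun _ : Fin (d + 1) => Set.Ioo (0:ℝ) 1))) ∧ MeasureTheory.volume (B \ ⋃ i, Φ i '' Set.pi Set.univ (fun _ : Fin (d + 1) => Set.Ioo (0:ℝ) 1)) = 0 ∧ ∀ i j, (∃ U : Set (Fin (d + 1) → ℝ), IsOpen U ∧ Set.pi Set.univ (fun _ : Fin (d + 1) => Set.Icc (0:ℝ) 1) ⊆ U ∧ ∃ (a₀ b₀ : Fin (d + 1) → ℕ) (e₀ : (Fin (d + 1) → ℝ) → ℝ) (L₁ L₂ : ℕ) (m₁ : Fin L₁ → ℕ) (a₁ b₁ a₂ b₂ : Fin L₁ → Fin (d + 1) → ℕ) (e₁ e₂ : Fin L₁ → (Fin (d + 1) → ℝ) → ℝ) (m₂ : Fin L₂ → ℕ) (a₃ b₃ a₄ b₄ a₅ b₅ : Fin L₂ → Fin (d + 1) → ℕ) (e₃ e₄ e₅ : Fin L₂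 → (Fin (d + 1) → ℝ) → ℝ), AnalyticOnNhd ℝ e₀ U ∧ (∀ x ∈ U, e₀ x ≠ 0) ∧ (∀ l, AnalyticOnNhd ℝ (e₁ l) U ∧ AnalyticOnNhd ℝ (e₂ l) U ∧ ∀ x ∈ U, 0 < e₁ l x ∧ 0 < e₂ l x) ∧ (∀ l, AnalyticOnNhd ℝ (e₃ l) U ∧ AnalyticOnNhd ℝ (e₄ l) U ∧ AnalyticOnNhd ℝ (e₅ l) U ∧ ∀ x ∈ U, 0 < e₃ l x ∧ 0 < e₄ l x ∧ 0 < e₅ l x) ∧ ∀ x ∈ U, (fun x => MvPolynomial.aeval (Φ i x) (Q j)) x = (∏ i, x i ^ a₀ i * (1 - x i) ^ b₀ i) * e₀ x * (∏ l, ((∏ i, x i ^ a₁ l i * (1 - x i) ^ b₁ l i) * e₁ l x + (∏ i, x i ^ a₂ l i * (1 - x i) ^ b₂ l i) * e₂ l x) ^ m₁ l) * ∏ l, (((∏ i, x i ^ a₃ l i * (1 - x i) ^ b₃ l i) * e₃ l x + (∏ i, x i ^ a₄ l i * (1 - x i) ^ b₄ l i) * e₄ l x) ^ 2 + (∏ i,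 x i ^ a₅ l i * (1 - x i) ^ b₅ l i) * e₅ l x) ^ m₂ l)) → (∀ (B : Set (Fin (d + 1) → ℝ)), IsSemialgebraic ℚ B → Bornology.IsBounded B → ∀ (k : ℕ) (Q : Fin k → MvPolynomial (Fin (d + 1)) ℚ), (∀ j, Q j ≠ 0) → ∃ (N : ℕ) (Φ : Fin N → (Fin (d + 1) → ℝ) → (Fin (d + 1) → ℝ)), (∀ i, (AnalyticOnNhd ℝ (Φ i) (Set.pi Set.univ (fun _ : Fin (d + 1) => Set.Icc (0:ℝ) 1)) ∧ IsSemialgebraicMapOn ℚ (Set.pi Set.univ (fun _ : Fin (d + 1) => Set.Ioo (0:ℝ) 1)) (Φ i) ∧ Set.InjOn (Φ i) (Set.pi Set.univ (fun _ : Fin (d + 1) => Set.Ioo (0:ℝ) 1)) ∧ ∀ x ∈ Set.pi Set.univ (fun _ : Fin (d + 1) => Set.Ioo (0:ℝ) 1), (fderiv ℝ (Φ i) x).det ≠ 0)) ∧ (∀ i, Φ i '' Set.pi Set.univ (fun _ : Fin (d + 1) => Set.Ioo (0:ℝ) 1) ⊆ B) ∧ Pairwise (fun i i' => Disjoint (Φ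 i '' Set.pi Set.univ (fun _ : Fin (d + 1) => Set.Ioo (0:ℝ) 1)) (Φ i' '' Set.pi Set.univ (fun _ : Fin (d + 1) => Set.Ioo (0:ℝ) 1))) ∧ MeasureTheory.volume (B \ ⋃ i, Φ i '' Set.pi Set.univ (fun _ : Fin (d + 1) => Set.Ioo (0:ℝ) 1)) = 0 ∧ ∀ i j, (∃ U : Set (Fin (d + 1) → ℝ), IsOpen U ∧ Set.pi Set.univ (fun _ : Fin (d + 1) => Set.Icc (0:ℝ) 1) ⊆ U ∧ ∃ (a b : Fin (d + 1) → ℕ) (e : (Fin (d + 1) → ℝ) → ℝ), AnalyticOnNhd ℝ e U ∧ (∀ x ∈ U, e x ≠ 0) ∧ ∀ x ∈ U, (fun x => MvPolynomial.aeval (Φ i x) (Q j)) x = (∏ i, x i ^ a i * (1 - x i) ^ b i) * e x)) := by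
  sorry

/-- **Stub S5 `stub_abhyankarJung` (the Abhyankar–Jung theorem near the closed cube; hardest, XL, the
lead's).** A monic polynomial `P(x; T) = Tⁿ + Σ aₖ(x) Tᵏ` with coefficients real-analytic on an open
`U ⊇ [0,1]ᵈ` whose discriminant `Res_T(P, P')` equals `(∏ xᵢ^{αᵢ}) · e(x)` with `e` analytic and
nowhere zero on `U` splits, after a ramification `xᵢ = σᵢ^N`, as `∏ (T − ζ_l(σ))` with
`ζ_l : ℝᵈ → ℂ` analytic on an open `V ⊇ [0,1]ᵈ`. (Locally at each point of the closed cube this is the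
Abhyankar–Jung theorem for the quasi-ordinary polynomial `P` over `ℂ{x − p}` — Parusiński–Rond's proof:
Tschirnhaus, `ν`-quasi-ordinarity of the Newton polyhedron, Hensel splitting in the Henselian ring of
convergent series (tree: `MvPowerSeries/WeierstrassDivision`), induction on the degree — and the local
root systems glue along the simply connected pieces of `V ∖ {∏ σᵢ = 0}`.)
[Abhyankar 1955, Thm. 3; Kiyek–Vicente 2004, Cor. V.3.3; Parusiński–Rond 2012, Thm. 1.1–1.2] -/
theorem stub_abhyankarJung : ∀ d : ℕ, (∀ (n : ℕ) (U : Set (Fin d → ℝ)), IsOpen U → Set.pi Set.univ (fun _ : Fin d => Set.Icc (0:ℝ) 1) ⊆ U → ∀ (a : Fin n → (Fin d → ℝ) → ℝ) (α : Fin d → ℕ) (e : (Fin d → ℝ) → ℝ), (∀ k, AnalyticOnNhd ℝ (a k) U) → AnalyticOnNhd ℝ e U → (∀ x ∈ U, e x ≠ 0) → (∀ x ∈ U, Polynomial.resultant (Polynomial.X ^ n + ∑ k : Fin n, Polynomial.C (a k (x)) * Polynomial.X ^ (k : ℕ)) (Polynomial.derivative (Polynomial.X ^ n + ∑ k : Fin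 n, Polynomial.C (a k (x)) * Polynomial.X ^ (k : ℕ))) = (∏ i, x i ^ α i) * e x) → ∃ N : ℕ, 0 < N ∧ ∃ V : Set (Fin d → ℝ), IsOpen V ∧ Set.pi Set.univ (fun _ : Fin d => Set.Icc (0:ℝ) 1) ⊆ V ∧ (∀ σ ∈ V, (fun i => σ i ^ N) ∈ U) ∧ ∃ ζ : Fin n → (Fin d → ℝ) → ℂ, (∀ l, AnalyticOnNhd ℝ (ζ l) V) ∧ ∀ σ ∈ V, ((Polynomial.X ^ n + ∑ k : Fin n, Polynomial.C (a k (fun i => σ i ^ N)) * Polynomial.X ^ (k : ℕ))).map (algebraMap ℝ ℂ) = ∏ l, (Polynomial.X - Polynomial.C (ζ l σ))) :=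
  Summit.KontsevichZagierPeriods.SymplecticScissors.CubeNashNormalFormAbhyankarJung.stub_abhyankarJung

/-- **Stub S6 `stub_toricPrincipalization` (simplicial toric charts, M–L).** For a finite set `S` of
exponent vectors in `ℕⁿ` there are finitely many monomial maps `v ↦ (∏ⱼ vⱼ^{A i j})ᵢ`, `A ∈ ℕ^{n×n}`
with `det A ≠ 0`, whose open-cube images are pairwise disjoint and cover the open cube up to a null
set, such that on each chart the pulled-back exponents `Aᵀa`, `a ∈ S`, are pairwise comparable
componentwise: in logarithmic coordinates `L = −log v ∈ (0,∞)ⁿ` these are the maximal cones (columns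
of `A` = rational ray generators) of any SIMPLICIAL fan refining the chambers of the arrangement
`⟨a − b, L⟩ = 0` (`a, b ∈ S`) inside the positive orthant. [Fulton 1993, §2.6; Goward 2005, §2] -/
theorem stub_toricPrincipalization : ∀ n : ℕ, (∀ (S : Finset (Fin n → ℕ)), ∃ (M : ℕ) (A : Fin M → Matrix (Fin n) (Fin n) ℕ), (∀ c, ((A c).map (fun t : ℕ => (t : ℝ))).det ≠ 0) ∧ Pairwise (fun c c' => Disjoint ((fun v : Fin n → ℝ => fun i => ∏ j, v j ^ A c i j) '' Set.pi Set.univ (fun _ : Fin n => Set.Ioo (0:ℝ) 1)) ((fun v : Fin n → ℝ => fun i => ∏ j, v j ^ A c' i j) '' Set.pi Set.univ (fun _ : Fin n => Set.Ioo (0:ℝ) 1))) ∧ MeasureTheory.volume (Set.pi Set.univ (fun _ : Fin n => Set.Ioo (0:ℝ) 1) \ ⋃ c, (fun v : Fin n → ℝ => fun i => ∏ j, v j ^ A c i j) '' Set.pi Set.univ (fun _ : Fin n => Set.Ioo (0:ℝ) 1)) = 0 ∧ ∀ c, ∀ a ∈ S, ∀ b ∈ S, (∀ j, ∑ i, A c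 i j * a i ≤ ∑ i, A c i j * b i) ∨ (∀ j, ∑ i, A c i j * b i ≤ ∑ i, A c i j * a i)) :=
  Summit.KontsevichZagierPeriods.SymplecticScissors.CubeNashNormalFormToricPrincipalization.stub_toricPrincipalization

/-- **Stub S7 `stub_rootDifferenceDivisor` (divisors of a normal-crossing monomial, M–L).** If
`f · g = (∏ xᵢ^{aᵢ}) · e` on an open `U ⊇ [0,1]ᵈ` with `f, g, e : ℝᵈ → ℂ` real-analytic and `e`
nowhere zero, then `f = (∏ xᵢ^{bᵢ}) · u` near the closed cube with `b ≤ a` and `u` analytic, nowhere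
zero: at each point `p` of the cube expand in convergent power series (tree:
`MvPowerSeries/OfAnalytic`, `EvalAnalytic`); the Newton polyhedra of the two factors add up to the
orthant `a(p) + ℝ₊ᵈ`, hence each is a translated orthant, i.e. each factor is a monomial times a unit of
`ℂ{x − p}`; the exponent along the face `xᵢ = 0` is locally constant, the quotient glues.
[Kiyek–Vicente 2004, Rem. V.4.4; Grauert–Remmert 1971, Kap. I §3] -/
theorem stub_rootDifferenceDivisor : ∀ d : ℕ, (∀ (U : Set (Fin d → ℝ)), IsOpen U → Set.pi Set.univ (fun _ : Fin d => Set.Icc (0:ℝ) 1) ⊆ U → ∀ (f g e : (Fin d → ℝ) → ℂ) (a : Fin d → ℕ), AnalyticOnNhd ℝ f U → AnalyticOnNhd ℝ g U → AnalyticOnNhd ℝ e U → (∀ x ∈ U, e x ≠ 0) → (∀ x ∈ U, f x * g x = (∏ i, ((x i : ℝ) : ℂ) ^ a i) * e x) → ∃ (b : Fin d → ℕ) (V : Set (Fin d → ℝ)) (u : (Fin d → ℝ) → ℂ), IsOpen V ∧ Set.pi Set.univ (fun _ : Fin d => Set.Icc (0:ℝ) 1) ⊆ V ∧ V ⊆ U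 ∧ AnalyticOnNhd ℝ u V ∧ (∀ x ∈ V, u x ≠ 0) ∧ (∀ i, b i ≤ a i) ∧ ∀ x ∈ V, f x = (∏ i, ((x i : ℝ) : ℂ) ^ b i) * u x) :=
  Summit.KontsevichZagierPeriods.SymplecticScissors.CubeNashNormalFormRootDifferenceDivisor.stub_rootDifferenceDivisor

/-! ## Composition (sorry-free) -/

/-- **Cube-monomialization `E(d)` for every `d ≥ 1`** (the card's `CubeMonomialization d`), by
Jung's induction: `E(1)` is stub S2; `E(d) ⇒ E(d+1)` (`d ≥ 1`) is JungPrepare (with Abhyankar–Jung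
and the divisor lemma) followed by JungFinish (with the toric charts).
[Jung 1908; Kollár 2007, §2.3; Bierstone–Milman 1988, Thm. 0.2] -/
theorem cubeMonomialization_of_le (d : ℕ) (hd : 1 ≤ d) : (∀ (B : Set (Fin d → ℝ)), IsSemialgebraic ℚ B → Bornology.IsBounded B → ∀ (k : ℕ) (Q : Fin k → MvPolynomial (Fin d) ℚ), (∀ j, Q j ≠ 0) → ∃ (N : ℕ) (Φ : Fin N → (Fin d → ℝ) → (Fin d → ℝ)), (∀ i, (AnalyticOnNhd ℝ (Φ i) (Set.pi Set.univ (fun _ : Fin d => Set.Icc (0:ℝ) 1)) ∧ IsSemialgebraicMapOn ℚ (Set.pi Set.univ (fun _ : Fin d => Set.Ioo (0:ℝ) 1)) (Φ i) ∧ Set.InjOn (Φ i) (Set.pi Set.univ (fun _ : Fin d => Set.Ioo (0:ℝ) 1)) ∧ ∀ x ∈ Set.pi Set.univ (fun _ : Fin d => Set.Ioo (0:ℝ) 1), (fderiv ℝ (Φ i) x).det ≠ 0)) ∧ (∀ i, Φ i '' Set.pi Set.univ (fun _ : Fin d => Set.Ioo (0:ℝ) 1) ⊆ B) ∧ Pairwise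 (fun i i' => Disjoint (Φ i '' Set.pi Set.univ (fun _ : Fin d => Set.Ioo (0:ℝ) 1)) (Φ i' '' Set.pi Set.univ (fun _ : Fin d => Set.Ioo (0:ℝ) 1))) ∧ MeasureTheory.volume (B \ ⋃ i, Φ i '' Set.pi Set.univ (fun _ : Fin d => Set.Ioo (0:ℝ) 1)) = 0 ∧ ∀ i j, (∃ U : Set (Fin d → ℝ), IsOpen U ∧ Set.pi Set.univ (fun _ : Fin d => Set.Icc (0:ℝ) 1) ⊆ U ∧ ∃ (a b : Fin d → ℕ) (e : (Fin d → ℝ) → ℝ), AnalyticOnNhd ℝ e U ∧ (∀ x ∈ U, e x ≠ 0) ∧ ∀ x ∈ U, (fun x => MvPolynomial.aeval (Φ i x) (Q j)) x = (∏ i, x i ^ a i * (1 - x i) ^ b i) * e x)) := by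
  induction d, hd using Nat.le_induction with
  | base => exact stub_cubeMonomializationOne
  | succ d hd ih =>
    exact stub_jungFinish d (stub_toricPrincipalization (d + 1))
      (stub_jungPrepare d hd ih (stub_abhyankarJung d) (stub_rootDifferenceDivisor d))

/-- **Tame cell atlas of a bounded solid** (= the registered `stub_tameCellAtlas` /
`stub_localUniformization` of the two sibling skeletons, in this line's FORMAT): `E(m+3)` with the
empty family of polynomials. [Hironaka 1973 (rectilinearization); Bierstone–Milman 1988, Thm. 0.2] -/
theorem exists_atlas (m : ℕ) (S : Set (Fin (m + 3) → ℝ)) (hS : IsSemialgebraic ℚ S)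
    (hb : Bornology.IsBounded S) :
    ∃ (N : ℕ) (Φ : Fin N → (Fin (m + 3) → ℝ) → (Fin (m + 3) → ℝ)), (∀ i, (AnalyticOnNhd ℝ (Φ i) (Set.pi Set.univ (fun _ : Fin (m + 3) => Set.Icc (0:ℝ) 1)) ∧ IsSemialgebraicMapOn ℚ (Set.pi Set.univ (fun _ : Fin (m + 3) => Set.Ioo (0:ℝ) 1)) (Φ i) ∧ Set.InjOn (Φ i) (Set.pi Set.univ (fun _ : Fin (m + 3) => Set.Ioo (0:ℝ) 1)) ∧ ∀ x ∈ Set.pi Set.univ (fun _ : Fin (m + 3) => Set.Ioo (0:ℝ) 1), (fderiv ℝ (Φ i) x).det ≠ 0)) ∧ (∀ i, Φ i '' Set.pi Set.univ (fun _ : Fin (m + 3) => Set.Ioo (0:ℝ) 1) ⊆ S) ∧ Pairwise (fun i i' => Disjoint (Φ i '' Set.pi Set.univ (fun _ : Fin (m + 3) => Set.Ioo (0:ℝ) 1)) (Φ i' '' Set.pi Set.univ (fun _ : Fin (m + 3) => Set.Ioo (0:ℝ) 1))) ∧ MeasureTheory.volume (S \ ⋃ i, Φ i '' Set.pi Set.univ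 (fun _ : Fin (m + 3) => Set.Ioo (0:ℝ) 1)) = 0 := by
  obtain ⟨N, Φ, hF, hsub, hdisj, hnull, -⟩ := cubeMonomialization_of_le (m + 3) (by omega) S hS hb 0
    (fun j => Fin.elim0 j) (fun j => Fin.elim0 j)
  exact ⟨N, Φ, hF, hsub, hdisj, hnull⟩

/-- **The hypothesis of the landed reduction**: every bounded integrand-`1` solid of dimension `≥ 3` is,
modulo `KZ.relations`, in the span of the tame cube classes (atlas + compiler).
[Kontsevich–Zagier 2001, §1.2; Viu-Sos 2021, Thm. 1.1] -/
theorem boundedCubeResolution_three (m : ℕ) (K : IntegralRep (m + 3))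
    (hKb : Bornology.IsBounded K.domain) (hK1 : ∀ x ∈ K.domain, K.integrand x = 1) :
    ∃ c : FormalRep, c ∈ Summit.KontsevichZagierPeriods.FurushoPentagon.ReducedPeriodRing.cubicalSpan ∧
      of K - c ∈ relations := by
  obtain ⟨N, Φ, hF, hsub, hdisj, hnull⟩ := exists_atlas m K.domain K.isSemialgebraic_domain hKb
  obtain ⟨c, hc, e⟩ := stub_chartCompiler (m + 3) K hK1 N Φ hF hsub hdisj hnull
  exact ⟨c, hc, e⟩

/-- **The crux by name (home decl, route LiftingCriteria), modulo the seven stubs.**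
[Kontsevich–Zagier 2001, §1.2; Viu-Sos 2021, Thm. 1.1] -/
theorem CubeNashNormalForm_of :
    Summit.KontsevichZagierPeriods.KontsevichZagierPeriods.Theses.LiftingCriteria.CubeNashNormalForm :=
  Summit.KontsevichZagierPeriods.LiftingCriteria.CubeNashNormalFormDimLeOne.cubeNashNormalForm_of_boundedCubeResolution_three
    boundedCubeResolution_three

/-- The same conclusion for the SymplecticScissors route decl of the shared item (byte-identical body).
[Kontsevich–Zagier 2001, §1.2] -/
theorem CubeNashNormalForm_of' :
    Summit.KontsevichZagierPeriods.KontsevichZagierPeriods.Theses.SymplecticScissors.CubeNashNormalForm :=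
  CubeNashNormalForm_of

/-- The same conclusion for the DimensionBudget route decl of the shared item (byte-identical body).
[Kontsevich–Zagier 2001, §1.2] -/
theorem CubeNashNormalForm_of'' :
    Summit.KontsevichZagierPeriods.KontsevichZagierPeriods.Theses.DimensionBudget.CubeNashNormalForm :=
  CubeNashNormalForm_of

end Summit.KontsevichZagierPeriods.KontsevichZagierPeriods.Cruxes.CubeNashNormalForm.JungToric

end
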